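import Mathlib
import Summits.MatrixMultiplication.MatrixMultiplication.Theorems.SnSubsetDichotomyPolynomialSlackKeptSplitBC
import Summits.MatrixMultiplication.MatrixMultiplication.Theorems.SnSubsetDichotomyPolynomialSlackPairHeavyMass
import Summits.MatrixMultiplication.MatrixMultiplication.Theorems.SnSubsetDichotomyPolynomialSlackStubSplit
import Summits.MatrixMultiplication.MatrixMultiplication.Theorems.SnSubsetDichotomyPolynomialSlackHubAtoms
import Literature.Combinatorics.Additive.TPPGroupAlgebra

/-!
# At most one dense quotient: the ATOMS volume bound

Crux `Summit.MatrixMultiplication.MatrixMultiplication.Theses.SnSubsetDichotomy.PolynomialSlack`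
(item `stmt-MatrixMultiplication-8306`), level-one programme, lead c9 (programme B, the atoms endgame),
line transport-split-hull. The atoms form of `volume_le_of_split_BC_sharp` (file `…SplitBCSharp`): for a
parity-pure TPP triple `S, T, U ⊆ S_n` (`n ≥ 40`) whose quotients `B = T⁻¹U` and `C = U⁻¹S` are
NON-DENSE at scale `M` (`K_B = n!/(|T||U|) ≥ 16M`, `K_C = n!/(|U||S|) ≥ 16M`), the kept level-one
inequality (`kept_split_BC`), the heavy-mass bounds of the two profiles (`pair_heavy_mass`, total `≤ Λ`)
and the ATOMS hub bound `volume_le_of_hub_atoms` (no sharp-mass hypothesis; instead the co-density cap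
`log(K_B K_C) ≤ 1.34 log n` and the ranges `E1, E3, E4, E5` of `Λ` against `n`) give

  `|S||T||U| ≤ 2·10³⁵·Λ⁶·(1+log n)⁸·log²(8000·Λ·K_A)·n^{1.49}·B`   (`K_A = n!/(|S||T|)`)

for every bound `B` on the volumes of TPP triples of `S_{n-1}`, as soon as the explicit level-one error
`δ = n!/(2N) + n!√(n!)/(2N√(n(n-1)/6)) + 3√(100(1+log n)L/M)·F/√(n-1)` (`F = n!√(n!)/N`) is at most
`1/1000` (`volume_le_of_split_BC_atoms`).
-/

namespace Summit.MatrixMultiplication.MatrixMultiplication.Theorems.PolynomialSlack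

open scoped BigOperators
open Literature.Combinatorics.Additive (TripleProductProperty)

-- `Summit.<Summit>.<Problem>` is the tree's mandated summit-side namespace (CONVENTIONS §2); for
-- this single-conjunct summit the two coincide, so each declaration silences `dupNamespace`.
set_option linter.dupNamespace false

/-- **At most one dense quotient: the atoms volume bound** (registered sub-goal
`volume_le_of_split_BC_atoms` of programme B, the atoms endgame). For `n ≥ 40`, a parity-pure TPP triple of
non-empty sets with `K_B, K_C ≥ 16M` (`M ≥ 1`), logarithms `log(4n·n!/|T||U|), log(4n·n!/|U||S|) ≤ L`
(`L ≥ 1`), `200(1+log n)L ≤ Λ`, the explicit level-one error `δ ≤ 1/1000`, the co-density cap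
`log(K_B K_C) ≤ 1.34 log n` and the four ranges `E1, E3, E4, E5` of `Λ` against `n`:
`|S||T||U| ≤ 2·10³⁵·Λ⁶·(1+log n)⁸·log²(8000·Λ·K_A)·n^{1.49}·B`. Proof: the thresholds
`θ_B = K_B/(nM)`, `θ_C = K_C/(nM)` are `≥ 16/n`; `kept_split_BC` gives the kept inequality,
`pair_heavy_mass` (via `injOn_quot_second`, `injOn_quot_first`) the two heavy masses `≤ Λ`, and
`volume_le_of_hub_atoms` concludes. [folklore] -/
theorem volume_le_of_split_BC_atoms {n : ℕ} (hn : 40 ≤ n) (B : ℕ)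
    (hB : ∀ S' T' U' : Finset (Equiv.Perm (Fin (n - 1))), TripleProductProperty S' T' U' →
      S'.card * T'.card * U'.card ≤ B)
    {S T U : Finset (Equiv.Perm (Fin n))} (hTPP : TripleProductProperty S T U)
    (hS0 : S.Nonempty) (hT0 : T.Nonempty) (hU0 : U.Nonempty)
    (hS : ∀ s ∈ S, ∀ s' ∈ S, Equiv.Perm.sign s = Equiv.Perm.sign s')
    (hT : ∀ t ∈ T, ∀ t' ∈ T, Equiv.Perm.sign t = Equiv.Perm.sign t')
    (hU : ∀ u ∈ U, ∀ u' ∈ U, Equiv.Perm.sign u = Equiv.Perm.sign u')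
    (M L Λ : ℝ) (hM : 1 ≤ M) (hL : 1 ≤ L) (hΛ : 200 * (1 + Real.log n) * L ≤ Λ)
    (hKB : 16 * M ≤ (n.factorial : ℝ) / (T.card * U.card : ℕ))
    (hKC : 16 * M ≤ (n.factorial : ℝ) / (U.card * S.card : ℕ))
    (hLB : Real.log (4 * n * n.factorial / (T.card * U.card : ℕ)) ≤ L)
    (hLC : Real.log (4 * n * n.factorial / (U.card * S.card : ℕ)) ≤ L)
    (hsmall : (n.factorial : ℝ) / (2 * (S.card * T.card * U.card : ℕ)) +
        (n.factorial : ℝ) * Real.sqrt (n.factorial : ℝ) /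
          (2 * (S.card * T.card * U.card : ℕ) * Real.sqrt (((n * (n - 1) : ℕ) : ℝ) / 6)) +
        3 * Real.sqrt (100 * (1 + Real.log n) * L / M) *
          ((n.factorial : ℝ) * Real.sqrt (n.factorial : ℝ) / (S.card * T.card * U.card : ℕ)) /
            Real.sqrt ((n : ℝ) - 1) ≤ 1 / 1000)
    (hQ : Real.log (((n.factorial : ℝ) / (T.card * U.card : ℕ)) *
        ((n.factorial : ℝ) / (U.card * S.card : ℕ))) ≤ 134 / 100 * Real.log n)
    (hE1 : Real.log (2 * 10 ^ 10 * Λ ^ 2 * n * (1 + Real.log n) *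
        Real.log (8000 * Λ * ((n.factorial : ℝ) / (S.card * T.card : ℕ)))) ≤ 101 / 100 * Real.log n)
    (hE3 : 8 * 10 ^ 8 * Λ ^ 4 * (1 + Real.log n) ^ 2 ≤ (n : ℝ))
    (hE4 : 16 * Real.log (160000 * Λ * (1 + Real.log n)) + 4 ≤ 5 / 1000 * Real.log n)
    (hE5 : Real.log (40000 * Λ ^ 2 * (1 + Real.log n)) ≤ 45 / 1000 * Real.log n) :
    ((S.card * T.card * U.card : ℕ) : ℝ) ≤
      2 * 10 ^ 35 * Λ ^ 6 * (1 + Real.log n) ^ 8 *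
        (Real.log (8000 * Λ * ((n.factorial : ℝ) / (S.card * T.card : ℕ)))) ^ 2 *
          (n : ℝ) ^ (149 / 100 : ℝ) * B := by
  classical
  have hn1 : 1 ≤ n := by omega
  have hnR : (40 : ℝ) ≤ n := by exact_mod_cast hn
  have hn0 : (0 : ℝ) < n := by linarith
  have hM0 : 0 < M := by linarith
  have hf0 : (0 : ℝ) < n.factorial := by exact_mod_cast n.factorial_pos
  have hβ0 : (0 : ℝ) < (T.card * U.card : ℕ) := by exact_mod_cast Nat.mul_pos hT0.card_pos hU0.card_pos
  have hγ0 : (0 : ℝ) < (U.card * S.card : ℕ) := by exact_mod_cast Nat.mul_pos hU0.card_pos hS0.card_pos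
  -- the thresholds
  set θB : ℝ := (n.factorial : ℝ) / ((T.card * U.card : ℕ) * n * M) with hθB
  set θC : ℝ := (n.factorial : ℝ) / ((U.card * S.card : ℕ) * n * M) with hθC
  have hθB16 : 16 / (n : ℝ) ≤ θB := by
    rw [hθB, div_le_div_iff₀ hn0 (by positivity)]
    rw [le_div_iff₀ hβ0] at hKB
    nlinarith
  have hθC16 : 16 / (n : ℝ) ≤ θC := by
    rw [hθC, div_le_div_iff₀ hn0 (by positivity)]
    rw [le_div_iff₀ hγ0] at hKC
    nlinarith
  -- the profiles and the heavy parts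
  set dA : Fin n → Fin n → ℝ := fun i j =>
    (((S ×ˢ T).filter fun st => st.2 j = st.1 i).card : ℝ) / (S.card * T.card : ℕ) with hdA
  set dB : Fin n → Fin n → ℝ := fun j k =>
    (((T ×ˢ U).filter fun tu => tu.2 k = tu.1 j).card : ℝ) / (T.card * U.card : ℕ) with hdB
  set dC : Fin n → Fin n → ℝ := fun k i =>
    (((U ×ˢ S).filter fun us => us.2 i = us.1 k).card : ℝ) / (U.card * S.card : ℕ) with hdC
  set pB : Fin n → Fin n → ℝ := fun j k => if θB ≤ dB j k then dB j k - 1 / n else 0 with hpB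
  set pC : Fin n → Fin n → ℝ := fun k i => if θC ≤ dC k i then dC k i - 1 / n else 0 with hpC
  -- (1) the kept inequality
  have hkept := kept_split_BC hn hTPP hS0 hT0 hU0 hS hT hU dA dB dC pB pC (fun _ _ => rfl)
    (fun _ _ => rfl) (fun _ _ => rfl) M L hM hL hKB hKC hLB hLC (fun _ _ => rfl) (fun _ _ => rfl)
  -- (2) the heavy masses
  have hG0 : 0 ≤ 1 + Real.log n := by
    have := Real.log_nonneg (show (1 : ℝ) ≤ n by linarith); linarith
  have hinjB := injOn_quot_second hTPP hS0
  have hinjC := injOn_quot_first hTPP.rotate.rotate hT0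
  have hmassB : ∑ j : Fin n, ∑ k : Fin n, (if θB ≤ dB j k then dB j k else 0) ≤ Λ := by
    have h := pair_heavy_mass hn1 T U hT0 hU0 hinjB dB (fun _ _ => rfl) θB hθB16
    refine h.trans (le_trans ?_ hΛ)
    have : Real.log (4 * n * n.factorial / (T.card * U.card : ℕ)) * (200 * (1 + Real.log n)) ≤
        L * (200 * (1 + Real.log n)) := mul_le_mul_of_nonneg_right hLB (by positivity)
    linarith
  have hmassC : ∑ k : Fin n, ∑ i : Fin n, (if θC ≤ dC k i then dC k i else 0) ≤ Λ := by
    have h := pair_heavy_mass hn1 U S hU0 hS0 hinjC dC (fun _ _ => rfl) θC hθC16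
    refine h.trans (le_trans ?_ hΛ)
    have : Real.log (4 * n * n.factorial / (U.card * S.card : ℕ)) * (200 * (1 + Real.log n)) ≤
        L * (200 * (1 + Real.log n)) := mul_le_mul_of_nonneg_right hLC (by positivity)
    linarith
  -- (3) the atoms hub bound
  have hΛ1 : 1 ≤ Λ := by
    have hG1 : 1 ≤ 1 + Real.log n := by linarith [Real.log_nonneg (show (1 : ℝ) ≤ n by linarith)]
    have : (1 : ℝ) * 1 ≤ (1 + Real.log n) * L := mul_le_mul hG1 hL zero_le_one hG0
    linarith
  set δ : ℝ := (n.factorial : ℝ) / (2 * (S.card * T.card * U.card : ℕ)) +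
      (n.factorial : ℝ) * Real.sqrt (n.factorial : ℝ) /
        (2 * (S.card * T.card * U.card : ℕ) * Real.sqrt (((n * (n - 1) : ℕ) : ℝ) / 6)) +
      3 * Real.sqrt (100 * (1 + Real.log n) * L / M) *
        ((n.factorial : ℝ) * Real.sqrt (n.factorial : ℝ) / (S.card * T.card * U.card : ℕ)) /
          Real.sqrt ((n : ℝ) - 1) with hδ
  exact volume_le_of_hub_atoms hn B hB hTPP hS0 hT0 hU0 dA dB dC pB pC (fun _ _ => rfl) (fun _ _ => rfl)
    (fun _ _ => rfl) θB θC Λ δ hθB16 hθC16 (fun _ _ => rfl) (fun _ _ => rfl) hΛ1 hsmall hmassB hmassC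
    hkept hQ hE1 hE3 hE4 hE5

end Summit.MatrixMultiplication.MatrixMultiplication.Theorems.PolynomialSlack
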